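import Mathlib
import HarnessLib
import Summits.PneNP.PneNP.Theorems.AeaCutRectanglesSparseCoreLemma
import Summits.PneNP.PneNP.Theorems.FoolingMeasure.Negative.FoolingMeasureFalseOfHalfSparseCore

/-!
# Crux `FoolingMeasure` (stmt-PneNP-19727): SPARSE CRITICAL CORES CANNOT BE FOOLED

Lead prover pnp-aea-p1 g2 (2026-08-27), route `AeaCutRectangles`.  Two further refuted weakenings of X1
`Summit.PneNP.PneNP.Theses.AeaCutRectangles.FoolingMeasure`, obtained by feeding the proved sparse case of
HALF-SPARSE CORE (`AeaCutRectanglesSparseCoreLemma.halfSparse_of_sparse_core`) into the union bound of the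
conditional refutation (`FoolingMeasure.Negative.total_le_of_halfSparseCore`, Bob-superset rectangles of the pairs
`(B, F[B])`, Stirling count against the threshold at `C = 4`):

* **`foolingMeasure_false_for_sparseCores`** — supports each containing a non-3-colourable subgraph `F` with a
  colour-critical edge and `3|F| + 20 ≤ 8n` (i.e. some 4-critical core with `≤ (8n-20)/3` edges) cannot fool;
* **`foolingMeasure_false_for_fewEdges`** — supports each having `≤ (8n-20)/3` edges cannot fool (a minimal
  non-3-colourable subgraph is such a core).

So every X1 support graph has MORE than `8n/3 - 7` edges and so has EACH of its 4-critical subgraphs — average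
degree `> 16/3 - o(1)` for the graph and for its sparsest critical core, far above the Kostochka–Yancey minimum
`10/3` of 4-critical graphs; this upgrades `AeaCutRectanglesNoSparseSupports.foolingMeasure_false_for_sparseObstructions`
(`< n/4` edges) by a factor `> 10`.  Analysis: `Cruxes/FoolingMeasure/Lines/duty-analysis-g2.md`.

HONEST FRAMING: elementary counting; FRONTIER material for a rung of Fagin's complement ladder (NON-3-COL vs
ESO(∀∃∀)); restricted-model witness — nothing here bears on P vs NP.
-/

set_option linter.dupNamespace false
set_option autoImplicit false

namespace Summit.PneNP.PneNP.Theorems.AeaCutRectanglesSparseCores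

open Finset
open Summit.PneNP.PneNP.Theorems.AeaCutRectanglesDutyRectangles
open Summit.PneNP.PneNP.Theorems.AeaCutRectanglesSparseWitnesses
open Summit.PneNP.PneNP.Theorems.AeaCutRectanglesNoSparseSupports
open Summit.PneNP.PneNP.Theorems.FoolingMeasure.Negative
open Summit.PneNP.PneNP.Theorems.AeaCutRectanglesSparseCoreLemma

/-! ### X1 restricted to supports with a sparse critical core is false -/

/-- **Sparse cores cannot be fooled.**  The weakening of the construction space of
`Summit.PneNP.PneNP.Theses.AeaCutRectangles.FoolingMeasure` to measures each of whose support graphs contains a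
non-3-colourable subgraph `F` with a colour-critical edge and `3|F| + 20 ≤ 8n` (every inclusion-minimal
non-3-colourable subgraph has critical edges, so: "some 4-critical core with `≤ (8n-20)/3` edges") makes the
statement FALSE — `halfSparse_of_sparse_core` feeds `FoolingMeasure.Negative.total_le_of_halfSparseCore`, and the
Stirling count beats the threshold at `C = 4`.  Hence EVERY 4-critical subgraph of an X1 support graph has more
than `8n/3 - 7` edges (average degree `> 16/3 - o(1)`). -/
theorem foolingMeasure_false_for_sparseCores :
    ¬ ∃ ε : ℝ, 0 < ε ∧ ε ≤ 1 / 4 ∧ ∀ C : ℕ, ∃ᶠ n in Filter.atTop, ∃ μ : Finset (Sym2 (Fin n)) → ℝ,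
      (∀ S, 0 ≤ μ S) ∧ (∑ S, μ S = 1) ∧
      (∀ S, μ S ≠ 0 → (∀ e ∈ S, ¬ e.IsDiag) ∧
        ¬ (SimpleGraph.fromEdgeSet (S : Set (Sym2 (Fin n)))).Colorable 3) ∧
      (∀ S, μ S ≠ 0 → ∃ F, F ⊆ S ∧ ¬ (SimpleGraph.fromEdgeSet (F : Set (Sym2 (Fin n)))).Colorable 3 ∧
        (∃ e ∈ F, (SimpleGraph.fromEdgeSet ((F.erase e : Finset (Sym2 (Fin n))) :
          Set (Sym2 (Fin n)))).Colorable 3) ∧ 3 * F.card + 20 ≤ 8 * n) ∧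
      ∀ B : Finset (Fin n), (1 / 2 - ε) * (n : ℝ) ≤ B.card → (B.card : ℝ) ≤ (1 / 2 + ε) * n →
        ∀ 𝓐 𝓑 : Finset (Finset (Sym2 (Fin n))),
          (∀ α ∈ 𝓐, ∀ e ∈ α, ¬ e.IsDiag ∧ ∃ v ∈ e, v ∉ B) →
          (∀ β ∈ 𝓑, ∀ e ∈ β, ¬ e.IsDiag ∧ ∀ v ∈ e, v ∈ B) →
          (∀ α ∈ 𝓐, ∀ β ∈ 𝓑,
            ¬ (SimpleGraph.fromEdgeSet ((α ∪ β : Finset (Sym2 (Fin n))) : Set (Sym2 (Fin n)))).Colorable 3) →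
          ∑ q ∈ 𝓐 ×ˢ 𝓑, μ (q.1 ∪ q.2) ≤ (2 : ℝ) ^ (-((n : ℝ) / 2 * Real.logb 2 n) - (C : ℝ) * n) := by
  rintro ⟨ε, hε0, -, hC⟩
  obtain ⟨N₀, hN₀⟩ := exists_nat_gt (1 / ε)
  obtain ⟨n, hnN, μ, hμ, hsum, hs, hrestr, hX⟩ := Filter.frequently_atTop.1 (hC 4) (N₀ + 2)
  have hn2 : 2 ≤ n := by omega
  have hnε : (1 : ℝ) ≤ ε * n := by
    have hNn : (N₀ : ℝ) ≤ n := by exact_mod_cast (show N₀ ≤ n by omega)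
    have h := mul_le_mul_of_nonneg_left hNn hε0.le
    have h' : 1 < ε * N₀ := by
      rw [div_lt_iff₀ hε0] at hN₀
      linarith
    linarith
  set δ : ℝ := (2 : ℝ) ^ (-((n : ℝ) / 2 * Real.logb 2 n) - ((4 : ℕ) : ℝ) * n) with hδ
  have hδpos : 0 < δ := Real.rpow_pos_of_pos (by norm_num) _
  set m : ℕ := n / 2 with hm
  have hrestr' : ∀ S, μ S ≠ 0 → ∃ B : Finset (Fin n),
      ((1 / 2 - ε) * (n : ℝ) ≤ B.card ∧ (B.card : ℝ) ≤ (1 / 2 + ε) * n) ∧ ∃ F, F ⊆ S ∧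
        ¬ (SimpleGraph.fromEdgeSet (F : Set (Sym2 (Fin n)))).Colorable 3 ∧ (bobSide B F).card ≤ m := by
    intro S hS
    obtain ⟨hSl, -⟩ := hs S hS
    obtain ⟨F, hFS, hF, ⟨e, he, hFe⟩, hcard⟩ := hrestr S hS
    obtain ⟨T, hT, hTF⟩ := halfSparse_of_sparse_core hn2 F (fun e' he' => hSl e' (hFS he')) hF he hFe hcard
    obtain ⟨B, hBT, hBcard⟩ := exists_subset_card_eq (show (n + 1) / 2 ≤ T.card by omega)
    refine ⟨B, ⟨?_, ?_⟩, F, hFS, hF, ?_⟩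
    · rw [hBcard]
      have : (n : ℝ) ≤ 2 * (((n + 1) / 2 : ℕ) : ℝ) := by
        exact_mod_cast (show n ≤ 2 * ((n + 1) / 2) by omega)
      nlinarith
    · rw [hBcard]
      have : 2 * (((n + 1) / 2 : ℕ) : ℝ) ≤ n + 1 := by
        exact_mod_cast (show 2 * ((n + 1) / 2) ≤ n + 1 by omega)
      nlinarith
    · have := card_le_card (bobSide_mono_left hBT F)
      omega
  have htot := total_le_of_halfSparseCore μ hμ hs
    (fun B : Finset (Fin n) => (1 / 2 - ε) * (n : ℝ) ≤ B.card ∧ (B.card : ℝ) ≤ (1 / 2 + ε) * n)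
    hδpos.le (fun B hB => hX B hB.1 hB.2) m hrestr'
  rw [hsum, Fintype.card_fin] at htot
  have hP : (((univ : Finset (Finset (Sym2 (Fin n)))).filter (fun H => H.card ≤ m)).card : ℝ) ≤
      (((n / 2 + 1) * (Fintype.card (Sym2 (Fin n))).choose (n / 2) : ℕ) : ℝ) := by
    have h := card_filter_card_le_choose (Sym2 (Fin n)) m
      ((show 2 * m ≤ n by omega).trans (le_card_sym2_fin (by omega)))
    exact_mod_cast h
  have hlt := halfSparse_count_lt_one hn2
  rw [← hδ] at hlt
  have h2n : (0 : ℝ) ≤ ((2 ^ n : ℕ) : ℝ) := by positivity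
  have := mul_le_mul_of_nonneg_left (mul_le_mul_of_nonneg_right hP hδpos.le) h2n
  linarith

/-- **Graphs with few edges cannot be fooled.**  X1 restricted to measures each of whose support graphs has at most
`(8n-20)/3` edges (`3|G| + 20 ≤ 8n`) is FALSE: a minimal non-3-colourable subgraph is a sparse core in the sense of
`foolingMeasure_false_for_sparseCores`.  So every X1 support graph has average degree `> 16/3 - 14/n`. -/
theorem foolingMeasure_false_for_fewEdges :
    ¬ ∃ ε : ℝ, 0 < ε ∧ ε ≤ 1 / 4 ∧ ∀ C : ℕ, ∃ᶠ n in Filter.atTop, ∃ μ : Finset (Sym2 (Fin n)) → ℝ,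
      (∀ S, 0 ≤ μ S) ∧ (∑ S, μ S = 1) ∧
      (∀ S, μ S ≠ 0 → (∀ e ∈ S, ¬ e.IsDiag) ∧
        ¬ (SimpleGraph.fromEdgeSet (S : Set (Sym2 (Fin n)))).Colorable 3) ∧
      (∀ S, μ S ≠ 0 → 3 * S.card + 20 ≤ 8 * n) ∧
      ∀ B : Finset (Fin n), (1 / 2 - ε) * (n : ℝ) ≤ B.card → (B.card : ℝ) ≤ (1 / 2 + ε) * n →
        ∀ 𝓐 𝓑 : Finset (Finset (Sym2 (Fin n))),
          (∀ α ∈ 𝓐, ∀ e ∈ α, ¬ e.IsDiag ∧ ∃ v ∈ e, v ∉ B) →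
          (∀ β ∈ 𝓑, ∀ e ∈ β, ¬ e.IsDiag ∧ ∀ v ∈ e, v ∈ B) →
          (∀ α ∈ 𝓐, ∀ β ∈ 𝓑,
            ¬ (SimpleGraph.fromEdgeSet ((α ∪ β : Finset (Sym2 (Fin n))) : Set (Sym2 (Fin n)))).Colorable 3) →
          ∑ q ∈ 𝓐 ×ˢ 𝓑, μ (q.1 ∪ q.2) ≤ (2 : ℝ) ^ (-((n : ℝ) / 2 * Real.logb 2 n) - (C : ℝ) * n) := by
  classical
  rintro ⟨ε, hε0, hε1, hC⟩
  apply foolingMeasure_false_for_sparseCores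
  refine ⟨ε, hε0, hε1, fun C => (hC C).mono fun n hn => ?_⟩
  obtain ⟨μ, hμ, hsum, hs, hfew, hX⟩ := hn
  refine ⟨μ, hμ, hsum, hs, fun S hS => ?_, hX⟩
  obtain ⟨-, hSc⟩ := hs S hS
  -- a minimal non-3-colourable subgraph of S
  set 𝓕 : Finset (Finset (Sym2 (Fin n))) :=
    S.powerset.filter (fun F => ¬ (SimpleGraph.fromEdgeSet (F : Set (Sym2 (Fin n)))).Colorable 3) with h𝓕
  have hS𝓕 : S ∈ 𝓕 := mem_filter.2 ⟨mem_powerset.2 (Subset.refl _), hSc⟩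
  obtain ⟨F, hF𝓕, hFmin⟩ := exists_min_image 𝓕 (fun F => F.card) ⟨S, hS𝓕⟩
  obtain ⟨hFS, hF⟩ := mem_filter.1 hF𝓕
  rw [mem_powerset] at hFS
  have hFne : F.Nonempty := by
    rw [nonempty_iff_ne_empty]
    rintro rfl
    apply hF
    exact ⟨SimpleGraph.Coloring.mk (fun _ => 0) (by simp)⟩
  obtain ⟨e, he⟩ := hFne
  refine ⟨F, hFS, hF, ⟨e, he, ?_⟩, ?_⟩
  · by_contra hcol
    have hmem : F.erase e ∈ 𝓕 :=
      mem_filter.2 ⟨mem_powerset.2 ((erase_subset _ _).trans hFS), hcol⟩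
    have := hFmin _ hmem
    rw [card_erase_of_mem he] at this
    have : 0 < F.card := card_pos.2 ⟨e, he⟩
    omega
  · have := card_le_card hFS
    have := hfew S hS
    omega

end Summit.PneNP.PneNP.Theorems.AeaCutRectanglesSparseCores
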